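import Literature.AlgebraicGeometry.Motives.SimplePoleTateConjecture
import HarnessLib

/-!
# The cohomology of the two quadrics of `ℙ^{2l+3}` over a finite field in a Galois Weil cohomology theory:
# `b_{2r}(ℋ) = b_{2r}(ℰ) = 1 + [r = l+1]`, `b_odd = 0`; `det(1 − T·F | H^{2l+2}) = (1 − q^{l+1}T)²` for the hyperbolic
# quadric `ℋ` and `(1 − q^{l+1}T)(1 + q^{l+1}T)` for the elliptic quadric `ℰ`: `F² = q^{2l+2}`, `φ_{l+1}² = 1 ≠ φ_{l+1}`,
# the anti-invariant line `Ker(φ_{l+1} + 1)`, and all middle classes of `ℰ` become Tate classes over `𝔽_{q²}`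

Topic `Literature/AlgebraicGeometry/Motives`; THEOREMS ONLY (no definition, no instance, no named fact; D-0026).
`E`-valued sequel to rows g51-#8 (`Motives/SplitQuadricPointCount`: `#ℋ(𝔽_{q^m}) = Σ_{r≤2l+2}(1 + [r = l+1])q^{mr}`,
`Z(ℋ,T)·∏(1 − qⁱT)·(1 − q^{l+1}T) = 1`), g51-#11 (`Motives/EllipticQuadricPointCount`: `#ℰ(𝔽_{q^m}) = Σ q^{mi} +
(−q^{l+1})^m`, `P_{2l+2}(ℰ) = 1 − q^{2l+2}T²`, uniqueness of the Weil factorisation), g52-#1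
(`Motives/QuadricNormalFormsSmooth`: both quadrics are smooth projective of dimension `2l+2`) and g52-#2
(`Motives/SimplePoleTateConjecture`: `Tʳ(ℰ)` for all `r`, `Tʳ(ℋ)` off the middle).  For a Galois Weil cohomology `E`
over the finite field `k` (`q = #k`) with the Lefschetz trace formula and `χ(φ) = q`, granted the Riemann hypothesis
for the quadric in `E` (Deligne 1974 for `E = H_ℓ`):

* §1 the (hE : E.HasLefschetzTraceFormula)
    (hχ : ((χ (arithFrob k) : Kˣ) : K) = Nat.card k)ERBOLIC quadric `ℋ_{2l+3} = V₊(Σ_{i≤l+1} εᵢxᵢx_{2l+3−i})` has a POLYNOMIAL point count, so the tree's engine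
  `Motives/PolynomialPointCountsBettiNumbers` (Göttsche's Remark 1.2.2) applies verbatim, as for `ℙⁿ` and the
  Grassmannian of lines (g51-#6): **`finrank_splitQuadric_two_mul`** (`b_{2r}(ℋ) = 1 + [r = l+1]`, `r ≤ 2l+2`),
  `finrank_splitQuadric_of_odd`, `finrank_splitQuadric` (all degrees), `finrank_splitQuadric_middle` (`= 2`: the two
  rulings), **`frobCharPoly_splitQuadric_two_mul`** (`P_{2r}(ℋ, T) = (1 − qʳT)^{b_{2r}}`),
  `charpoly_frobAction_splitQuadric_two_mul`, `frobAction_sub_pow_eq_zero_splitQuadric` (`(F − qʳ)^{b_{2r}} = 0`),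
  **`frobAction_splitQuadric_eq_of_ne`** (`F = qʳ` on the line `H^{2r}(ℋ)`, `r ≠ l+1`),
  `maxGenEigenspace_ρTwist_splitQuadric_eq_top` (every class is a generalised Tate class),
  `ker_ρTwist_sub_one_splitQuadric_eq_top_of_semisimple`, **`algebraicClasses_splitQuadric_eq_top_of_ne`**
  (`K·Aʳ(ℋ) = H^{2r}(ℋ)` for `r ≠ l+1`, unconditionally: `ηʳ` spans the line), and in the middle
  **`algebraicClasses_splitQuadric_middle_eq_top_iff`** (`K·A^{l+1}(ℋ) = H^{2l+2}(ℋ) ⟺ dim K·A^{l+1}(ℋ) = 2`) with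
  **`consequences_splitQuadric_middle_of_algebraicClasses_eq_top`** (then `T^{l+1}(ℋ) ∧ S ∧` hom = num, by g52-#2).
* §2 the (hypersurface ((∑ i : Fin (l + 1), MvPolynomial.X (Fin.castLE (leE l) i) *
          MvPolynomial.X (Fin.rev (Fin.castLE (leE l) i))) + MvPolynomial.X (Fin.mk (l + 1) (ltE₁ l)) ^ 2 -
          MvPolynomial.C ε * MvPolynomial.X (Fin.mk (l + 2) (ltE₂ l)) ^ 2 : MvPolynomial (Fin (2 * l + 2 + 2)) k))IPTIC quadric `ℰ_{2l+3} = V₊(Σ_{i≤l} xᵢx_{2l+3−i} + x_{l+1}² − εx_{l+2}²)` (`ε` a non-square): its count is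
  NOT polynomial, and the Betti numbers come from the unique Weil factorisation of g51-#11:
  **`finrank_ellipticQuadric`** (`bᵢ(ℰ) = bᵢ(ℋ)`: `1 + [i = 2l+2]` for `i` even `≤ 4l+4`, else `0`),
  `finrank_ellipticQuadric_middle` (`= 2`), `finrank_ellipticQuadric_two_mul_of_ne` (`= 1`), `finrank_ellipticQuadric_of_odd`,
  **`finrank_ellipticQuadric_eq_finrank_splitQuadric`**; **`frobCharPoly_ellipticQuadric`**
  (`Pᵢ(ℰ, T)`: `1 − q^{i/2}T` off the middle, **`1 − q^{2l+2}T² = (1 − q^{l+1}T)(1 + q^{l+1}T)`** in the middle, `1` for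
  `i` odd), **`charpoly_frobAction_ellipticQuadric_middle`** (`det(T − F | H^{2l+2}(ℰ)) = (T − q^{l+1})(T + q^{l+1})`),
  **`frobAction_sq_ellipticQuadric_middle`** (`F² = q^{2l+2}`), `isSemisimple_frobAction_ellipticQuadric_middle`,
  **`ρTwist_sq_ellipticQuadric_middle`** (`φ_{l+1}² = 1`), **`ρTwist_ellipticQuadric_middle_ne_one`** (`φ_{l+1} ≠ 1`: the
  second ruling is not rational over `𝔽_q`), **`finrank_ker_ρTwist_add_one_ellipticQuadric_middle`** (the
  ANTI-invariant classes `Ker(φ_{l+1} + 1)` form a line — the difference of the two rulings),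
  `ker_sub_one_sup_ker_add_one_ellipticQuadric_middle` (`H^{2l+2}(ℰ)(l+1) = Ker(φ − 1) ⊕ Ker(φ + 1)`), and over `𝔽_{q²}`:
  **`ρTwist_geomFrob_sq_ellipticQuadric_middle`** (`φ_{l+1}(F²) = 1`: EVERY class of `H^{2l+2}(ℰ)(l+1)` is fixed by the
  Frobenius of `𝔽_{q²}` — both rulings become rational, matching the DOUBLE pole of `Z(ℰ ⊗ 𝔽_{q²}, T)` of g51-#11 §7).

What is NOT here: the classes of the rulings as cycle classes (so `K·A^{l+1}(ℋ) = H^{2l+2}(ℋ)` stays an `iff`);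
characteristic `2`.  HC is not touched.

## Sources, read on the page

A. Weil [Weil1949] p. 507 («`B_h = degree of P_h`»; the `α_{hi}`).  J. W. P. Hirschfeld [Hirschfeld1998] §5.2
Thm. 5.2.4, Thm. 5.2.6 (ii)–(iii) (`ψ₊`, `ψ₋`).  B. Kahn [Kahn2020] §3.6 Remark 3.66 (the quadric surface: «the two
families of lines … are exchanged by Frobenius», sign `−1`), §6.14 Conj. 6.52 ∕ Th. 6.53.  J. Tate [Tate1994] §1,
§2 Th. 2.9; [TateWoodsHole1965] §3.  L. Göttsche [Gottsche1993] §1.2 Thm. 1.2.1 (5), Remark 1.2.2 (polynomial count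
⟹ Betti numbers and eigenvalues).  P. Deligne [Deligne1974] (1.5.4), Th. (1.6).  J. S. Milne
[Milne1986ValuesZetaFunctionsFiniteFields] §8 Prop. 8.2.  S. Kleiman [Kleiman1968] §1.2 (A), (C).

## References

* [Weil1949] A. Weil, Numbers of solutions of equations in finite fields, Bull. AMS 55 (1949), p. 507.
* [Hirschfeld1998] J. W. P. Hirschfeld, Projective Geometries over Finite Fields, 2nd ed. (1998), §5.2 Thm. 5.2.4,
  Thm. 5.2.6.
* [Kahn2020] B. Kahn, Zeta and L-Functions of Varieties and Motives (2020), §3.6 Remark 3.66, §6.14 Th. 6.53.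
* [Tate1994] J. Tate, Conjectures on algebraic cycles in ℓ-adic cohomology, PSPM 55.1 (1994), §1, §2 Th. 2.9.
* [TateWoodsHole1965] J. Tate, Algebraic cycles and poles of zeta functions (1965), §3.
* [Gottsche1993] L. Göttsche, Hilbert schemes of zero-dimensional subschemes of smooth varieties, LNM 1572, §1.2.
* [Deligne1974] P. Deligne, La conjecture de Weil. I, Publ. Math. IHÉS 43 (1974), (1.5.4), Th. (1.6).
* [Milne1986ValuesZetaFunctionsFiniteFields] J. S. Milne, Values of zeta functions of varieties over finite fields,
  Amer. J. Math. 108 (1986), §8 Prop. 8.2.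
* [Kleiman1968] S. Kleiman, Algebraic cycles and the Weil conjectures (1968), §1.2.
* Tree: `Motives/PolynomialPointCountsBettiNumbers`, `Motives/ProjectiveSpaceFiniteFieldCohomology` and
  `Motives/GrassmannianOfLinesFiniteFieldCohomology` (the patterns), `Motives/FrobeniusTracesIndependentOfTheory`
  (`finrank_eq_natDegree_of_isIntegralModel`), `NumberTheory/LFunctions/WeilConjecturesFactorizationProofs`
  (`isWeilFactorization_of_isIntegralModel`), `Motives/SplitQuadricPointCount`, `Motives/EllipticQuadricPointCount`,
  `Motives/QuadricNormalFormsSmooth`, `Motives/SimplePoleTateConjecture`.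

## Provenance

Lane `lit-hodgefound` (summit `HodgeConjecture`, Track 2 foundations library, Layer B: motives ∕ varieties over finite
fields), seat `lit-hodgefound-p29` (literature-prover, generation 52, row g52-#3; FREE POINTER (β) of generation 51).
-/

universe u v

open Polynomial CategoryTheory AlgebraicGeometry
open Literature.NumberTheory.LFunctions (isWeilFactorization_of_isIntegralModel)

noncomputable section

namespace Literature.AlgebraicGeometry.Motives

namespace GaloisWeilCohomology

open SmoothHypersurface (hypersurface)

variable {k : Type u} [Field k] [Finite k] {K : Type v} [Field K] [CharZero K]
  {χ : Field.absoluteGaloisGroup k →* Kˣ} (E : GaloisWeilCohomology k K χ) (l : ℕ)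

/-- `(1 − qʳT) ∈ ℤ[T]` maps to `1 − qʳT ∈ R[T]`. [folklore] -/
private theorem map_one_sub_C_pow_mul_X_quadric {R : Type*} [CommRing R] (f : ℤ →+* R) (q r : ℕ) :
    ((1 - C ((q : ℤ) ^ r) * X : ℤ[X]).map f) = 1 - C ((q : R) ^ r) * X := by
  rw [Polynomial.map_sub, Polynomial.map_one, Polynomial.map_mul, Polynomial.map_C, Polynomial.map_X,
    map_pow, map_natCast]

/-- `(1 − qᵉT²) ∈ ℤ[T]` maps to `1 − qᵉT² ∈ R[T]`. [folklore] -/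
private theorem map_one_sub_C_pow_mul_X_sq_quadric {R : Type*} [CommRing R] (f : ℤ →+* R) (q e : ℕ) :
    ((1 - C ((q : ℤ) ^ e) * X ^ 2 : ℤ[X]).map f) = 1 - C ((q : R) ^ e) * X ^ 2 := by
  rw [Polynomial.map_sub, Polynomial.map_one, Polynomial.map_mul, Polynomial.map_C, Polynomial.map_pow,
    Polynomial.map_X, map_pow, map_natCast]

omit [Finite k] [CharZero K] in
/-- `reverse ((T − a)(T + a)) = (1 − aT)(1 + aT) = 1 − a²T²`. [folklore] -/
private theorem reverse_X_sub_C_mul_X_add_C (a : K) :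
    ((X - C a) * (X - C (-a))).reverse = 1 - C (a ^ 2) * X ^ 2 := by
  rw [reverse_mul_of_domain, Literature.NumberTheory.LFunctions.WeilFunctionalEquation.reverse_X_sub_C_eq,
    Literature.NumberTheory.LFunctions.WeilFunctionalEquation.reverse_X_sub_C_eq, map_neg, map_pow]
  ring

/-! ### §1 The hyperbolic quadric `ℋ_{2l+3}`: a polynomial count -/

section SplitQuadric

variable (ε : Fin (l + 2) → kˣ)

/-- `l + 2 ≤ 2l + 2 + 2` (any proof matches the tree's by proof irrelevance). [folklore] -/
private theorem leS (l : ℕ) : l + 2 ≤ 2 * l + 2 + 2 := by omega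

/-- **`b_{2r}(ℋ) = 1 + [r = l+1]` for `r ≤ 2l+2`**: the polynomial count `#ℋ(𝔽_{q^m}) = Σ_{r≤2l+2}(1 + [r = l+1])q^{mr}`
(Hirschfeld's `ψ₊`) read in `E` (Göttsche's Remark 1.2.2; the tree's `finrank_eq_of_pointCount_eq_sum`).
[cite: Hirschfeld1998, §5.2 Thm. 5.2.6 (ii)] [cite: Gottsche1993, §1.2 Remark 1.2.2] [cite: Weil1949, p. 507] -/
theorem finrank_splitQuadric_two_mul (hE : E.HasLefschetzTraceFormula)
    (hχ : ((χ (arithFrob k) : Kˣ) : K) = Nat.card k)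
    (hRH : E.WeilRiemannHypothesisFor
      (hypersurface (∑ i : Fin (l + 2), MvPolynomial.C (ε i : k) * MvPolynomial.X (Fin.castLE (leS l) i) *
          MvPolynomial.X (Fin.rev (Fin.castLE (leS l) i)) : MvPolynomial (Fin (2 * l + 2 + 2)) k)) (2 * l + 2)) {r : ℕ} (hr : r ≤ 2 * l + 2) :
    Module.finrank K (E.obj
      (hypersurface (∑ i : Fin (l + 2), MvPolynomial.C (ε i : k) * MvPolynomial.X (Fin.castLE (leS l) i) *
          MvPolynomial.X (Fin.rev (Fin.castLE (leS l) i)) : MvPolynomial (Fin (2 * l + 2 + 2)) k)) (2 * r)) = if r = l + 1 then 2 else 1 := by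
  have h := E.finrank_eq_of_pointCount_eq_sum hE hχ (isSmoothProjective_splitQuadric l ε) hRH
    (fun _ hm => pointCount_splitQuadric_cast l ε hm) hr
  exact_mod_cast h

/-- **`bᵢ(ℋ) = 0` for `i` odd.** [cite: Hirschfeld1998, §5.2 Thm. 5.2.6 (ii)] [cite: Gottsche1993, §1.2 Remark 1.2.2] -/
theorem finrank_splitQuadric_of_odd (hE : E.HasLefschetzTraceFormula)
    (hχ : ((χ (arithFrob k) : Kˣ) : K) = Nat.card k)
    (hRH : E.WeilRiemannHypothesisFor
      (hypersurface (∑ i : Fin (l + 2), MvPolynomial.C (ε i : k) * MvPolynomial.X (Fin.castLE (leS l) i) *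
          MvPolynomial.X (Fin.rev (Fin.castLE (leS l) i)) : MvPolynomial (Fin (2 * l + 2 + 2)) k)) (2 * l + 2)) {i : ℕ} (hi : Odd i) :
    Module.finrank K (E.obj
      (hypersurface (∑ i : Fin (l + 2), MvPolynomial.C (ε i : k) * MvPolynomial.X (Fin.castLE (leS l) i) *
          MvPolynomial.X (Fin.rev (Fin.castLE (leS l) i)) : MvPolynomial (Fin (2 * l + 2 + 2)) k)) i) = 0 :=
  E.finrank_eq_zero_of_odd_of_pointCount_eq_sum hE hχ (isSmoothProjective_splitQuadric l ε) hRH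
    (fun _ hm => pointCount_splitQuadric_cast l ε hm) hi

/-- **The Betti numbers of the hyperbolic quadric `ℋ_{2l+3}`**: `bᵢ = 1 + [i = 2l+2]` for `i` even, `i ≤ 4l+4`, and
`bᵢ = 0` otherwise. [cite: Weil1949, p. 507] [cite: Gottsche1993, §1.2 Thm. 1.2.1 (5) and Remark 1.2.2]
[cite: Hirschfeld1998, §5.2 Thm. 5.2.6 (ii)] -/
theorem finrank_splitQuadric (hE : E.HasLefschetzTraceFormula)
    (hχ : ((χ (arithFrob k) : Kˣ) : K) = Nat.card k)
    (hRH : E.WeilRiemannHypothesisFor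
      (hypersurface (∑ i : Fin (l + 2), MvPolynomial.C (ε i : k) * MvPolynomial.X (Fin.castLE (leS l) i) *
          MvPolynomial.X (Fin.rev (Fin.castLE (leS l) i)) : MvPolynomial (Fin (2 * l + 2 + 2)) k)) (2 * l + 2)) (i : ℕ) :
    Module.finrank K (E.obj
      (hypersurface (∑ i : Fin (l + 2), MvPolynomial.C (ε i : k) * MvPolynomial.X (Fin.castLE (leS l) i) *
          MvPolynomial.X (Fin.rev (Fin.castLE (leS l) i)) : MvPolynomial (Fin (2 * l + 2 + 2)) k)) i) =
      if Even i ∧ i ≤ 2 * (2 * l + 2) then (if i / 2 = l + 1 then 2 else 1) else 0 := by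
  split_ifs with h h'
  · obtain ⟨⟨r, hr⟩, hi⟩ := h
    rw [hr, ← two_mul] at h' ⊢
    rw [Nat.mul_div_cancel_left r two_pos] at h'
    rw [E.finrank_splitQuadric_two_mul l ε hE hχ hRH (by omega), if_pos h']
  · obtain ⟨⟨r, hr⟩, hi⟩ := h
    rw [hr, ← two_mul] at h' ⊢
    rw [Nat.mul_div_cancel_left r two_pos] at h'
    rw [E.finrank_splitQuadric_two_mul l ε hE hχ hRH (by omega), if_neg h']
  · by_cases hi : Even i
    · exact E.finrank_obj_eq_zero (isSmoothProjective_splitQuadric l ε) (by have := not_and.mp h hi; omega)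
    · exact E.finrank_splitQuadric_of_odd l ε hE hχ hRH (Nat.not_even_iff_odd.mp hi)

/-- **`b_{2l+2}(ℋ) = 2`** (the middle cohomology of the hyperbolic quadric: the two rulings).
[cite: Kahn2020, §3.6 Remark 3.66] [cite: Hirschfeld1998, §5.2 Thm. 5.2.6 (ii)] -/
theorem finrank_splitQuadric_middle (hE : E.HasLefschetzTraceFormula)
    (hχ : ((χ (arithFrob k) : Kˣ) : K) = Nat.card k)
    (hRH : E.WeilRiemannHypothesisFor
      (hypersurface (∑ i : Fin (l + 2), MvPolynomial.C (ε i : k) * MvPolynomial.X (Fin.castLE (leS l) i) *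
          MvPolynomial.X (Fin.rev (Fin.castLE (leS l) i)) : MvPolynomial (Fin (2 * l + 2 + 2)) k)) (2 * l + 2)) :
    Module.finrank K (E.obj
      (hypersurface (∑ i : Fin (l + 2), MvPolynomial.C (ε i : k) * MvPolynomial.X (Fin.castLE (leS l) i) *
          MvPolynomial.X (Fin.rev (Fin.castLE (leS l) i)) : MvPolynomial (Fin (2 * l + 2 + 2)) k)) (2 * (l + 1))) = 2 := by
  rw [E.finrank_splitQuadric_two_mul l ε hE hχ hRH (by omega), if_pos rfl]

/-- **`b_{2r}(ℋ) = 1` off the middle** (`r ≤ 2l+2`, `r ≠ l+1`). [cite: Weil1949, p. 507] [cite: Hirschfeld1998, §5.2 Thm. 5.2.6 (ii)] -/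
theorem finrank_splitQuadric_two_mul_of_ne (hE : E.HasLefschetzTraceFormula)
    (hχ : ((χ (arithFrob k) : Kˣ) : K) = Nat.card k)
    (hRH : E.WeilRiemannHypothesisFor
      (hypersurface (∑ i : Fin (l + 2), MvPolynomial.C (ε i : k) * MvPolynomial.X (Fin.castLE (leS l) i) *
          MvPolynomial.X (Fin.rev (Fin.castLE (leS l) i)) : MvPolynomial (Fin (2 * l + 2 + 2)) k)) (2 * l + 2)) {r : ℕ} (hr : r ≤ 2 * l + 2) (hne : r ≠ l + 1) :
    Module.finrank K (E.obj
      (hypersurface (∑ i : Fin (l + 2), MvPolynomial.C (ε i : k) * MvPolynomial.X (Fin.castLE (leS l) i) *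
          MvPolynomial.X (Fin.rev (Fin.castLE (leS l) i)) : MvPolynomial (Fin (2 * l + 2 + 2)) k)) (2 * r)) = 1 := by
  rw [E.finrank_splitQuadric_two_mul l ε hE hχ hRH hr, if_neg hne]

/-- **`P_{2r}(ℋ, T) = det(1 − T·F | H^{2r}(ℋ)) = (1 − qʳT)^{b_{2r}(ℋ)}`** (`r ≤ 2l+2`; in particular
`P_{2l+2}(ℋ, T) = (1 − q^{l+1}T)²`). [cite: Weil1949, p. 507] [cite: Deligne1974, (1.5.4) and Th. (1.6)]
[cite: Kahn2020, §3.6 Remark 3.66] -/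
theorem frobCharPoly_splitQuadric_two_mul (hE : E.HasLefschetzTraceFormula)
    (hχ : ((χ (arithFrob k) : Kˣ) : K) = Nat.card k)
    (hRH : E.WeilRiemannHypothesisFor
      (hypersurface (∑ i : Fin (l + 2), MvPolynomial.C (ε i : k) * MvPolynomial.X (Fin.castLE (leS l) i) *
          MvPolynomial.X (Fin.rev (Fin.castLE (leS l) i)) : MvPolynomial (Fin (2 * l + 2 + 2)) k)) (2 * l + 2)) {r : ℕ} (hr : r ≤ 2 * l + 2) :
    E.frobCharPoly
        (hypersurface (∑ i : Fin (l + 2), MvPolynomial.C (ε i : k) * MvPolynomial.X (Fin.castLE (leS l) i) *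
          MvPolynomial.X (Fin.rev (Fin.castLE (leS l) i)) : MvPolynomial (Fin (2 * l + 2 + 2)) k)) (2 * r) =
      (1 - C ((Nat.card k : K) ^ r) * Polynomial.X) ^ (if r = l + 1 then 2 else 1) := by
  rw [E.frobCharPoly_eq_pow_of_pointCount_eq_sum hE hχ (isSmoothProjective_splitQuadric l ε) hRH
    (fun _ hm => pointCount_splitQuadric_cast l ε hm) r, E.finrank_splitQuadric_two_mul l ε hE hχ hRH hr]

/-- **`det(T − F | H^{2r}(ℋ)) = (T − qʳ)^{b_{2r}(ℋ)}`** (`r ≤ 2l+2`). [cite: Weil1949, p. 507] [cite: Deligne1974, Th. (1.6)] -/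
theorem charpoly_frobAction_splitQuadric_two_mul (hE : E.HasLefschetzTraceFormula)
    (hχ : ((χ (arithFrob k) : Kˣ) : K) = Nat.card k)
    (hRH : E.WeilRiemannHypothesisFor
      (hypersurface (∑ i : Fin (l + 2), MvPolynomial.C (ε i : k) * MvPolynomial.X (Fin.castLE (leS l) i) *
          MvPolynomial.X (Fin.rev (Fin.castLE (leS l) i)) : MvPolynomial (Fin (2 * l + 2 + 2)) k)) (2 * l + 2)) {r : ℕ} (hr : r ≤ 2 * l + 2) :
    (haveI := E.finite_obj (isSmoothProjective_splitQuadric l ε) (2 * r);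
      (E.frobAction
        (hypersurface (∑ i : Fin (l + 2), MvPolynomial.C (ε i : k) * MvPolynomial.X (Fin.castLE (leS l) i) *
          MvPolynomial.X (Fin.rev (Fin.castLE (leS l) i)) : MvPolynomial (Fin (2 * l + 2 + 2)) k)) (2 * r)).charpoly) =
      (Polynomial.X - C ((Nat.card k : K) ^ r)) ^ (if r = l + 1 then 2 else 1) := by
  rw [E.charpoly_frobAction_eq_pow_of_pointCount_eq_sum hE hχ (isSmoothProjective_splitQuadric l ε) hRH
    (fun _ hm => pointCount_splitQuadric_cast l ε hm) r, E.finrank_splitQuadric_two_mul l ε hE hχ hRH hr]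

/-- **`(F − qʳ)^{b_{2r}(ℋ)} = 0` on `H^{2r}(ℋ)`** (Cayley–Hamilton): in the middle `(F − q^{l+1})² = 0`.
[cite: Deligne1974, Th. (1.6)] [cite: Gottsche1993, §1.2 Remark 1.2.2] -/
theorem frobAction_sub_pow_eq_zero_splitQuadric (hE : E.HasLefschetzTraceFormula)
    (hχ : ((χ (arithFrob k) : Kˣ) : K) = Nat.card k)
    (hRH : E.WeilRiemannHypothesisFor
      (hypersurface (∑ i : Fin (l + 2), MvPolynomial.C (ε i : k) * MvPolynomial.X (Fin.castLE (leS l) i) *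
          MvPolynomial.X (Fin.rev (Fin.castLE (leS l) i)) : MvPolynomial (Fin (2 * l + 2 + 2)) k)) (2 * l + 2)) (r : ℕ) :
    (E.frobAction
          (hypersurface (∑ i : Fin (l + 2), MvPolynomial.C (ε i : k) * MvPolynomial.X (Fin.castLE (leS l) i) *
          MvPolynomial.X (Fin.rev (Fin.castLE (leS l) i)) : MvPolynomial (Fin (2 * l + 2 + 2)) k)) (2 * r) -
        algebraMap K (Module.End K (E.obj
          (hypersurface (∑ i : Fin (l + 2), MvPolynomial.C (ε i : k) * MvPolynomial.X (Fin.castLE (leS l) i) *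
          MvPolynomial.X (Fin.rev (Fin.castLE (leS l) i)) : MvPolynomial (Fin (2 * l + 2 + 2)) k)) (2 * r))) ((Nat.card k : K) ^ r)) ^
      Module.finrank K (E.obj
        (hypersurface (∑ i : Fin (l + 2), MvPolynomial.C (ε i : k) * MvPolynomial.X (Fin.castLE (leS l) i) *
          MvPolynomial.X (Fin.rev (Fin.castLE (leS l) i)) : MvPolynomial (Fin (2 * l + 2 + 2)) k)) (2 * r)) = 0 :=
  E.frobAction_sub_pow_eq_zero_of_pointCount_eq_sum hE hχ (isSmoothProjective_splitQuadric l ε) hRH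
    (fun _ hm => pointCount_splitQuadric_cast l ε hm) r

/-- **`F = qʳ` on `H^{2r}(ℋ)` off the middle** (`r ≤ 2l+2`, `r ≠ l+1`: `b_{2r} = 1`, `(F − qʳ)¹ = 0`).
[cite: Weil1949, p. 507] [cite: Deligne1974, Th. (1.6)] -/
theorem frobAction_splitQuadric_eq_of_ne (hE : E.HasLefschetzTraceFormula)
    (hχ : ((χ (arithFrob k) : Kˣ) : K) = Nat.card k)
    (hRH : E.WeilRiemannHypothesisFor
      (hypersurface (∑ i : Fin (l + 2), MvPolynomial.C (ε i : k) * MvPolynomial.X (Fin.castLE (leS l) i) *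
          MvPolynomial.X (Fin.rev (Fin.castLE (leS l) i)) : MvPolynomial (Fin (2 * l + 2 + 2)) k)) (2 * l + 2)) {r : ℕ} (hr : r ≤ 2 * l + 2) (hne : r ≠ l + 1) :
    E.frobAction
        (hypersurface (∑ i : Fin (l + 2), MvPolynomial.C (ε i : k) * MvPolynomial.X (Fin.castLE (leS l) i) *
          MvPolynomial.X (Fin.rev (Fin.castLE (leS l) i)) : MvPolynomial (Fin (2 * l + 2 + 2)) k)) (2 * r) =
      algebraMap K (Module.End K (E.obj
        (hypersurface (∑ i : Fin (l + 2), MvPolynomial.C (ε i : k) * MvPolynomial.X (Fin.castLE (leS l) i) *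
          MvPolynomial.X (Fin.rev (Fin.castLE (leS l) i)) : MvPolynomial (Fin (2 * l + 2 + 2)) k)) (2 * r))) ((Nat.card k : K) ^ r) := by
  have h := E.frobAction_sub_pow_eq_zero_splitQuadric l ε hE hχ hRH r
  rwa [E.finrank_splitQuadric_two_mul_of_ne l ε hE hχ hRH hr hne, pow_one, sub_eq_zero] at h

/-- **Every class of `H^{2r}(ℋ)(r)` is a generalised Tate class**: `H^{2r}(ℋ)(r)_{(φ),1} = H^{2r}(ℋ)(r)`.
[cite: Tate1994, §1] [cite: Gottsche1993, §1.2 Remark 1.2.2] -/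
theorem maxGenEigenspace_ρTwist_splitQuadric_eq_top (hE : E.HasLefschetzTraceFormula)
    (hχ : ((χ (arithFrob k) : Kˣ) : K) = Nat.card k)
    (hRH : E.WeilRiemannHypothesisFor
      (hypersurface (∑ i : Fin (l + 2), MvPolynomial.C (ε i : k) * MvPolynomial.X (Fin.castLE (leS l) i) *
          MvPolynomial.X (Fin.rev (Fin.castLE (leS l) i)) : MvPolynomial (Fin (2 * l + 2 + 2)) k)) (2 * l + 2)) (r : ℕ) :
    Module.End.maxGenEigenspace (E.ρTwist
      (hypersurface (∑ i : Fin (l + 2), MvPolynomial.C (ε i : k) * MvPolynomial.X (Fin.castLE (leS l) i) *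
          MvPolynomial.X (Fin.rev (Fin.castLE (leS l) i)) : MvPolynomial (Fin (2 * l + 2 + 2)) k)) (2 * r) r (geomFrob k)) 1 = ⊤ :=
  E.maxGenEigenspace_ρTwist_eq_top_of_pointCount_eq_sum hE hχ (isSmoothProjective_splitQuadric l ε) hRH
    (fun _ hm => pointCount_splitQuadric_cast l ε hm) r

/-- **Granted `S`, `φ_r = 1` on `H^{2r}(ℋ)(r)`** (all classes Tate classes). [cite: Tate1994, §1 (Conjecture S)]
[cite: Milne1986ValuesZetaFunctionsFiniteFields, §8 Prop. 8.2] -/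
theorem ker_ρTwist_sub_one_splitQuadric_eq_top_of_semisimple (hE : E.HasLefschetzTraceFormula)
    (hχ : ((χ (arithFrob k) : Kˣ) : K) = Nat.card k)
    (hRH : E.WeilRiemannHypothesisFor
      (hypersurface (∑ i : Fin (l + 2), MvPolynomial.C (ε i : k) * MvPolynomial.X (Fin.castLE (leS l) i) *
          MvPolynomial.X (Fin.rev (Fin.castLE (leS l) i)) : MvPolynomial (Fin (2 * l + 2 + 2)) k)) (2 * l + 2)) (r : ℕ)
    (hS : LinearMap.ker (E.ρTwist
          (hypersurface (∑ i : Fin (l + 2), MvPolynomial.C (ε i : k) * MvPolynomial.X (Fin.castLE (leS l) i) *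
          MvPolynomial.X (Fin.rev (Fin.castLE (leS l) i)) : MvPolynomial (Fin (2 * l + 2 + 2)) k)) (2 * r) r (geomFrob k) - 1) ⊓
        LinearMap.range (E.ρTwist
          (hypersurface (∑ i : Fin (l + 2), MvPolynomial.C (ε i : k) * MvPolynomial.X (Fin.castLE (leS l) i) *
          MvPolynomial.X (Fin.rev (Fin.castLE (leS l) i)) : MvPolynomial (Fin (2 * l + 2 + 2)) k)) (2 * r) r (geomFrob k) - 1) = ⊥) :
    LinearMap.ker (E.ρTwist
      (hypersurface (∑ i : Fin (l + 2), MvPolynomial.C (ε i : k) * MvPolynomial.X (Fin.castLE (leS l) i) *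
          MvPolynomial.X (Fin.rev (Fin.castLE (leS l) i)) : MvPolynomial (Fin (2 * l + 2 + 2)) k)) (2 * r) r (geomFrob k) - 1) = ⊤ :=
  E.ker_ρTwist_sub_one_eq_top_of_pointCount_eq_sum hE hχ (isSmoothProjective_splitQuadric l ε) hRH
    (fun _ hm => pointCount_splitQuadric_cast l ε hm) r hS

/-- **`K·Aʳ(ℋ) = H^{2r}(ℋ)` off the middle, unconditionally** (`r ≠ l+1`): for `r ≤ 2l+2` the line `H^{2r}(ℋ)` is
spanned by the algebraic class `ηʳ ≠ 0` (`η` a hyperplane class), beyond `2l+2` both sides vanish.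
[cite: Kleiman1968, §1.2 (A), (C)] [cite: Tate1994, §1 Conjecture T^r] -/
theorem algebraicClasses_splitQuadric_eq_top_of_ne (hE : E.HasLefschetzTraceFormula)
    (hχ : ((χ (arithFrob k) : Kˣ) : K) = Nat.card k)
    (hRH : E.WeilRiemannHypothesisFor
      (hypersurface (∑ i : Fin (l + 2), MvPolynomial.C (ε i : k) * MvPolynomial.X (Fin.castLE (leS l) i) *
          MvPolynomial.X (Fin.rev (Fin.castLE (leS l) i)) : MvPolynomial (Fin (2 * l + 2 + 2)) k)) (2 * l + 2)) {r : ℕ} (hne : r ≠ l + 1) :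
    E.algebraicClasses
      (hypersurface (∑ i : Fin (l + 2), MvPolynomial.C (ε i : k) * MvPolynomial.X (Fin.castLE (leS l) i) *
          MvPolynomial.X (Fin.rev (Fin.castLE (leS l) i)) : MvPolynomial (Fin (2 * l + 2 + 2)) k)) r = ⊤ := by
  have hX := isSmoothProjective_splitQuadric l ε
  rcases Nat.lt_or_ge (2 * l + 2) r with hr | hr
  · haveI := E.subsingleton_obj hX (show 2 * (2 * l + 2) < 2 * r by omega)
    exact eq_top_iff.2 fun x _ => by rw [Subsingleton.elim x 0]; exact Submodule.zero_mem _
  · obtain ⟨η, hη⟩ := E.isHyperplaneClass_nonempty hX (show 1 ≤ 2 * l + 2 by omega)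
    haveI := E.finite_obj hX (2 * r)
    have hone := E.finrank_splitQuadric_two_mul_of_ne l ε hE hχ hRH hr hne
    rw [eq_top_iff]
    rintro x -
    obtain ⟨c, hc⟩ := (finrank_eq_one_iff_of_nonzero' _ (E.pow_ne_zero_of_isHyperplaneClass hX hη hr)).mp hone x
    rw [← hc]
    exact Submodule.smul_mem _ c (E.pow_mem_algebraicClasses hX (E.hyperplaneClass_mem_algebraicClasses hX hη) r)

/-- **In the middle: `K·A^{l+1}(ℋ) = H^{2l+2}(ℋ)` iff `dim K·A^{l+1}(ℋ) = 2`** (`b_{2l+2}(ℋ) = 2`; the missing input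
is a second algebraic class independent of `η^{l+1}` — the two rulings). [cite: Kahn2020, §3.6 Remark 3.66]
[cite: TateWoodsHole1965, §3 (13)] -/
theorem algebraicClasses_splitQuadric_middle_eq_top_iff (hE : E.HasLefschetzTraceFormula)
    (hχ : ((χ (arithFrob k) : Kˣ) : K) = Nat.card k)
    (hRH : E.WeilRiemannHypothesisFor
      (hypersurface (∑ i : Fin (l + 2), MvPolynomial.C (ε i : k) * MvPolynomial.X (Fin.castLE (leS l) i) *
          MvPolynomial.X (Fin.rev (Fin.castLE (leS l) i)) : MvPolynomial (Fin (2 * l + 2 + 2)) k)) (2 * l + 2)) :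
    E.algebraicClasses
        (hypersurface (∑ i : Fin (l + 2), MvPolynomial.C (ε i : k) * MvPolynomial.X (Fin.castLE (leS l) i) *
          MvPolynomial.X (Fin.rev (Fin.castLE (leS l) i)) : MvPolynomial (Fin (2 * l + 2 + 2)) k)) (l + 1) = ⊤ ↔
      Module.finrank K (E.algebraicClasses
        (hypersurface (∑ i : Fin (l + 2), MvPolynomial.C (ε i : k) * MvPolynomial.X (Fin.castLE (leS l) i) *
          MvPolynomial.X (Fin.rev (Fin.castLE (leS l) i)) : MvPolynomial (Fin (2 * l + 2 + 2)) k)) (l + 1)) = 2 := by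
  haveI := E.finite_obj (isSmoothProjective_splitQuadric l ε) (2 * (l + 1))
  have h2 := E.finrank_splitQuadric_middle l ε hE hχ hRH
  constructor
  · intro h
    rw [h, finrank_top, h2]
  · intro h
    exact Submodule.eq_top_of_finrank_eq (h.trans h2.symm)

/-- **If the algebraic middle classes span `H^{2l+2}(ℋ)`, then `T^{l+1}(ℋ)`, `S` and hom = num in the middle hold**
(the pole order `2` equals the rank; g52-#2 `consequences_splitQuadric_middle_of_finrank_eq_two`).
[cite: Tate1994, §2 Th. 2.9] [cite: Kahn2020, §3.6 Remark 3.66 and §6.14 Th. 6.53] -/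
theorem consequences_splitQuadric_middle_of_algebraicClasses_eq_top (hE : E.HasLefschetzTraceFormula)
    (hχ : ((χ (arithFrob k) : Kˣ) : K) = Nat.card k)
    (hRH : E.WeilRiemannHypothesisFor
      (hypersurface (∑ i : Fin (l + 2), MvPolynomial.C (ε i : k) * MvPolynomial.X (Fin.castLE (leS l) i) *
          MvPolynomial.X (Fin.rev (Fin.castLE (leS l) i)) : MvPolynomial (Fin (2 * l + 2 + 2)) k)) (2 * l + 2))
    (htop : E.algebraicClasses
      (hypersurface (∑ i : Fin (l + 2), MvPolynomial.C (ε i : k) * MvPolynomial.X (Fin.castLE (leS l) i) *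
          MvPolynomial.X (Fin.rev (Fin.castLE (leS l) i)) : MvPolynomial (Fin (2 * l + 2 + 2)) k)) (l + 1) = ⊤) :
    E.TateConjectureFor
        (hypersurface (∑ i : Fin (l + 2), MvPolynomial.C (ε i : k) * MvPolynomial.X (Fin.castLE (leS l) i) *
          MvPolynomial.X (Fin.rev (Fin.castLE (leS l) i)) : MvPolynomial (Fin (2 * l + 2 + 2)) k)) (l + 1) ∧
      LinearMap.ker (E.ρTwist
            (hypersurface (∑ i : Fin (l + 2), MvPolynomial.C (ε i : k) * MvPolynomial.X (Fin.castLE (leS l) i) *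
          MvPolynomial.X (Fin.rev (Fin.castLE (leS l) i)) : MvPolynomial (Fin (2 * l + 2 + 2)) k)) (2 * (l + 1)) (l + 1 : ℕ) (geomFrob k) - 1) ⊓
          LinearMap.range (E.ρTwist
            (hypersurface (∑ i : Fin (l + 2), MvPolynomial.C (ε i : k) * MvPolynomial.X (Fin.castLE (leS l) i) *
          MvPolynomial.X (Fin.rev (Fin.castLE (leS l) i)) : MvPolynomial (Fin (2 * l + 2 + 2)) k)) (2 * (l + 1)) (l + 1 : ℕ) (geomFrob k) - 1) = ⊥ ∧
      ∀ c : AlgebraicCycle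
          (hypersurface (∑ i : Fin (l + 2), MvPolynomial.C (ε i : k) * MvPolynomial.X (Fin.castLE (leS l) i) *
          MvPolynomial.X (Fin.rev (Fin.castLE (leS l) i)) : MvPolynomial (Fin (2 * l + 2 + 2)) k)).left ℤ,
        E.IsNumericallyTrivial (2 * l + 2)
            (hypersurface (∑ i : Fin (l + 2), MvPolynomial.C (ε i : k) * MvPolynomial.X (Fin.castLE (leS l) i) *
          MvPolynomial.X (Fin.rev (Fin.castLE (leS l) i)) : MvPolynomial (Fin (2 * l + 2 + 2)) k)) (l + 1) c →
          E.IsHomologicallyTrivial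
            (hypersurface (∑ i : Fin (l + 2), MvPolynomial.C (ε i : k) * MvPolynomial.X (Fin.castLE (leS l) i) *
          MvPolynomial.X (Fin.rev (Fin.castLE (leS l) i)) : MvPolynomial (Fin (2 * l + 2 + 2)) k)) (l + 1) c :=
  E.consequences_splitQuadric_middle_of_finrank_eq_two l ε hE hχ hRH
    ((E.algebraicClasses_splitQuadric_middle_eq_top_iff l ε hE hχ hRH).mp htop)

end SplitQuadric

/-! ### §2 The elliptic quadric `ℰ_{2l+3}`: Betti numbers and Frobenius from the Weil factorisation -/

section EllipticQuadric

variable {ε : k}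

/-- `l + 1 ≤ 2l + 2 + 2` (any proof matches the tree's by proof irrelevance). [folklore] -/
private theorem leE (l : ℕ) : l + 1 ≤ 2 * l + 2 + 2 := by omega

/-- The middle coordinate `l + 1`. [folklore] -/
private theorem ltE₁ (l : ℕ) : l + 1 < 2 * l + 2 + 2 := by omega

/-- The middle coordinate `l + 2`. [folklore] -/
private theorem ltE₂ (l : ℕ) : l + 2 < 2 * l + 2 + 2 := by omega

/-- **The Betti numbers of the elliptic quadric `ℰ_{2l+3}`: `bᵢ(ℰ) = 1 + [i = 2l+2]` for `i` even, `i ≤ 4l+4`,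
`bᵢ(ℰ) = 0` otherwise** — the degrees of the `Pᵢ` of the unique Weil factorisation of `Z(ℰ, T)` (g51-#11), read in
`E` (`bᵢ = deg Pᵢ`), granted the trace formula, `χ(φ) = q` and RH for `ℰ` in `E`.
[cite: Weil1949, p. 507] [cite: Deligne1974, Th. (1.6)] [cite: Hirschfeld1998, §5.2 Thm. 5.2.6 (iii)] -/
theorem finrank_ellipticQuadric (hE : E.HasLefschetzTraceFormula)
    (hχ : ((χ (arithFrob k) : Kˣ) : K) = Nat.card k) (hε : ¬IsSquare ε)
    (hRH : E.WeilRiemannHypothesisFor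
      (hypersurface ((∑ i : Fin (l + 1), MvPolynomial.X (Fin.castLE (leE l) i) *
          MvPolynomial.X (Fin.rev (Fin.castLE (leE l) i))) + MvPolynomial.X (Fin.mk (l + 1) (ltE₁ l)) ^ 2 -
          MvPolynomial.C ε * MvPolynomial.X (Fin.mk (l + 2) (ltE₂ l)) ^ 2 : MvPolynomial (Fin (2 * l + 2 + 2)) k)) (2 * l + 2)) (i : ℕ) :
    Module.finrank K (E.obj
      (hypersurface ((∑ i : Fin (l + 1), MvPolynomial.X (Fin.castLE (leE l) i) *
          MvPolynomial.X (Fin.rev (Fin.castLE (leE l) i))) + MvPolynomial.X (Fin.mk (l + 1) (ltE₁ l)) ^ 2 -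
          MvPolynomial.C ε * MvPolynomial.X (Fin.mk (l + 2) (ltE₂ l)) ^ 2 : MvPolynomial (Fin (2 * l + 2 + 2)) k)) i) =
      if Even i ∧ i ≤ 2 * (2 * l + 2) then (if i / 2 = l + 1 then 2 else 1) else 0 := by
  have hX := isSmoothProjective_ellipticQuadric_of_not_isSquare l hε
  rcases le_or_gt i (2 * (2 * l + 2)) with hi2 | hi2
  · obtain ⟨P, hP, hroots⟩ := hRH
    have hW := isWeilFactorization_of_isIntegralModel E hE hχ hX hP hroots
    obtain ⟨ι, rfl⟩ : ∃ ι : Fin (2 * (2 * l + 2) + 1), (ι : ℕ) = i := ⟨⟨i, by omega⟩, rfl⟩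
    rw [E.finrank_eq_natDegree_of_isIntegralModel hX (hP ι), hW.natDegree_eq_of_ellipticQuadric l hε ι]
    simp only [hi2, and_true]
  · rw [E.finrank_obj_eq_zero hX hi2, if_neg (fun h => absurd h.2 (not_le.mpr hi2))]

/-- **`b_{2l+2}(ℰ) = 2`** (the two rulings over `𝔽̄_q`). [cite: Kahn2020, §3.6 Remark 3.66] [cite: Weil1949, p. 507] -/
theorem finrank_ellipticQuadric_middle (hE : E.HasLefschetzTraceFormula)
    (hχ : ((χ (arithFrob k) : Kˣ) : K) = Nat.card k) (hε : ¬IsSquare ε)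
    (hRH : E.WeilRiemannHypothesisFor
      (hypersurface ((∑ i : Fin (l + 1), MvPolynomial.X (Fin.castLE (leE l) i) *
          MvPolynomial.X (Fin.rev (Fin.castLE (leE l) i))) + MvPolynomial.X (Fin.mk (l + 1) (ltE₁ l)) ^ 2 -
          MvPolynomial.C ε * MvPolynomial.X (Fin.mk (l + 2) (ltE₂ l)) ^ 2 : MvPolynomial (Fin (2 * l + 2 + 2)) k)) (2 * l + 2)) :
    Module.finrank K (E.obj
      (hypersurface ((∑ i : Fin (l + 1), MvPolynomial.X (Fin.castLE (leE l) i) *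
          MvPolynomial.X (Fin.rev (Fin.castLE (leE l) i))) + MvPolynomial.X (Fin.mk (l + 1) (ltE₁ l)) ^ 2 -
          MvPolynomial.C ε * MvPolynomial.X (Fin.mk (l + 2) (ltE₂ l)) ^ 2 : MvPolynomial (Fin (2 * l + 2 + 2)) k)) (2 * (l + 1))) = 2 := by
  rw [E.finrank_ellipticQuadric l hE hχ hε hRH, if_pos ⟨even_two_mul _, by omega⟩, Nat.mul_div_cancel_left _ two_pos,
    if_pos rfl]

/-- **`b_{2r}(ℰ) = 1` off the middle** (`r ≤ 2l+2`, `r ≠ l+1`). [cite: Weil1949, p. 507] -/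
theorem finrank_ellipticQuadric_two_mul_of_ne (hE : E.HasLefschetzTraceFormula)
    (hχ : ((χ (arithFrob k) : Kˣ) : K) = Nat.card k) (hε : ¬IsSquare ε)
    (hRH : E.WeilRiemannHypothesisFor
      (hypersurface ((∑ i : Fin (l + 1), MvPolynomial.X (Fin.castLE (leE l) i) *
          MvPolynomial.X (Fin.rev (Fin.castLE (leE l) i))) + MvPolynomial.X (Fin.mk (l + 1) (ltE₁ l)) ^ 2 -
          MvPolynomial.C ε * MvPolynomial.X (Fin.mk (l + 2) (ltE₂ l)) ^ 2 : MvPolynomial (Fin (2 * l + 2 + 2)) k)) (2 * l + 2)) {r : ℕ} (hr : r ≤ 2 * l + 2) (hne : r ≠ l + 1) :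
    Module.finrank K (E.obj
      (hypersurface ((∑ i : Fin (l + 1), MvPolynomial.X (Fin.castLE (leE l) i) *
          MvPolynomial.X (Fin.rev (Fin.castLE (leE l) i))) + MvPolynomial.X (Fin.mk (l + 1) (ltE₁ l)) ^ 2 -
          MvPolynomial.C ε * MvPolynomial.X (Fin.mk (l + 2) (ltE₂ l)) ^ 2 : MvPolynomial (Fin (2 * l + 2 + 2)) k)) (2 * r)) = 1 := by
  rw [E.finrank_ellipticQuadric l hE hχ hε hRH, if_pos ⟨even_two_mul _, by omega⟩, Nat.mul_div_cancel_left _ two_pos,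
    if_neg hne]

/-- **`bᵢ(ℰ) = 0` for `i` odd.** [cite: Weil1949, p. 507] -/
theorem finrank_ellipticQuadric_of_odd (hE : E.HasLefschetzTraceFormula)
    (hχ : ((χ (arithFrob k) : Kˣ) : K) = Nat.card k) (hε : ¬IsSquare ε)
    (hRH : E.WeilRiemannHypothesisFor
      (hypersurface ((∑ i : Fin (l + 1), MvPolynomial.X (Fin.castLE (leE l) i) *
          MvPolynomial.X (Fin.rev (Fin.castLE (leE l) i))) + MvPolynomial.X (Fin.mk (l + 1) (ltE₁ l)) ^ 2 -
          MvPolynomial.C ε * MvPolynomial.X (Fin.mk (l + 2) (ltE₂ l)) ^ 2 : MvPolynomial (Fin (2 * l + 2 + 2)) k)) (2 * l + 2)) {i : ℕ} (hi : Odd i) :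
    Module.finrank K (E.obj
      (hypersurface ((∑ i : Fin (l + 1), MvPolynomial.X (Fin.castLE (leE l) i) *
          MvPolynomial.X (Fin.rev (Fin.castLE (leE l) i))) + MvPolynomial.X (Fin.mk (l + 1) (ltE₁ l)) ^ 2 -
          MvPolynomial.C ε * MvPolynomial.X (Fin.mk (l + 2) (ltE₂ l)) ^ 2 : MvPolynomial (Fin (2 * l + 2 + 2)) k)) i) = 0 := by
  rw [E.finrank_ellipticQuadric l hE hχ hε hRH, if_neg (fun h => (Nat.not_even_iff_odd.mpr hi) h.1)]

/-- **`bᵢ(ℰ) = bᵢ(ℋ)` for all `i`**: the elliptic and hyperbolic quadrics of `ℙ^{2l+3}` have the same Betti numbers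
(they become isomorphic over `𝔽_{q²}`), although their zeta functions differ in the middle factor.
[cite: Kahn2020, §3.6 Remark 3.66] [cite: Hirschfeld1998, §5.2 Thm. 5.2.6] -/
theorem finrank_ellipticQuadric_eq_finrank_splitQuadric (hE : E.HasLefschetzTraceFormula)
    (hχ : ((χ (arithFrob k) : Kˣ) : K) = Nat.card k) (hε : ¬IsSquare ε)
    (hRH : E.WeilRiemannHypothesisFor
      (hypersurface ((∑ i : Fin (l + 1), MvPolynomial.X (Fin.castLE (leE l) i) *
          MvPolynomial.X (Fin.rev (Fin.castLE (leE l) i))) + MvPolynomial.X (Fin.mk (l + 1) (ltE₁ l)) ^ 2 -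
          MvPolynomial.C ε * MvPolynomial.X (Fin.mk (l + 2) (ltE₂ l)) ^ 2 : MvPolynomial (Fin (2 * l + 2 + 2)) k)) (2 * l + 2))
    (ε' : Fin (l + 2) → kˣ)
    (hRH' : E.WeilRiemannHypothesisFor
      (hypersurface (∑ i : Fin (l + 2), MvPolynomial.C (ε' i : k) * MvPolynomial.X (Fin.castLE (leS l) i) *
          MvPolynomial.X (Fin.rev (Fin.castLE (leS l) i)) : MvPolynomial (Fin (2 * l + 2 + 2)) k)) (2 * l + 2)) (i : ℕ) :
    Module.finrank K (E.obj
      (hypersurface ((∑ i : Fin (l + 1), MvPolynomial.X (Fin.castLE (leE l) i) *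
          MvPolynomial.X (Fin.rev (Fin.castLE (leE l) i))) + MvPolynomial.X (Fin.mk (l + 1) (ltE₁ l)) ^ 2 -
          MvPolynomial.C ε * MvPolynomial.X (Fin.mk (l + 2) (ltE₂ l)) ^ 2 : MvPolynomial (Fin (2 * l + 2 + 2)) k)) i) =
    Module.finrank K (E.obj
      (hypersurface (∑ i : Fin (l + 2), MvPolynomial.C (ε' i : k) * MvPolynomial.X (Fin.castLE (leS l) i) *
          MvPolynomial.X (Fin.rev (Fin.castLE (leS l) i)) : MvPolynomial (Fin (2 * l + 2 + 2)) k)) i) := by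
  rw [E.finrank_ellipticQuadric l hE hχ hε hRH, E.finrank_splitQuadric l ε' hE hχ hRH']

/-- **`Pᵢ(ℰ, T) = det(1 − T·F | Hⁱ(ℰ))`**: `1 − q^{i/2}T` for `i` even `≤ 4l+4` off the middle,
**`1 − q^{2l+2}T²`** for `i = 2l+2`, `1` for `i` odd. [cite: Weil1949, p. 507] [cite: Deligne1974, (1.5.4) and Th. (1.6)]
[cite: Kahn2020, §3.6 Remark 3.66] -/
theorem frobCharPoly_ellipticQuadric (hE : E.HasLefschetzTraceFormula)
    (hχ : ((χ (arithFrob k) : Kˣ) : K) = Nat.card k) (hε : ¬IsSquare ε)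
    (hRH : E.WeilRiemannHypothesisFor
      (hypersurface ((∑ i : Fin (l + 1), MvPolynomial.X (Fin.castLE (leE l) i) *
          MvPolynomial.X (Fin.rev (Fin.castLE (leE l) i))) + MvPolynomial.X (Fin.mk (l + 1) (ltE₁ l)) ^ 2 -
          MvPolynomial.C ε * MvPolynomial.X (Fin.mk (l + 2) (ltE₂ l)) ^ 2 : MvPolynomial (Fin (2 * l + 2 + 2)) k)) (2 * l + 2)) {i : ℕ} (hi : i ≤ 2 * (2 * l + 2)) :
    E.frobCharPoly
        (hypersurface ((∑ i : Fin (l + 1), MvPolynomial.X (Fin.castLE (leE l) i) *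
          MvPolynomial.X (Fin.rev (Fin.castLE (leE l) i))) + MvPolynomial.X (Fin.mk (l + 1) (ltE₁ l)) ^ 2 -
          MvPolynomial.C ε * MvPolynomial.X (Fin.mk (l + 2) (ltE₂ l)) ^ 2 : MvPolynomial (Fin (2 * l + 2 + 2)) k)) i =
      if Even i then
        (if i / 2 = l + 1 then 1 - C ((Nat.card k : K) ^ (2 * (l + 1))) * Polynomial.X ^ 2
          else 1 - C ((Nat.card k : K) ^ (i / 2)) * Polynomial.X)
      else 1 := by
  have hX := isSmoothProjective_ellipticQuadric_of_not_isSquare l hε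
  obtain ⟨P, hP, hroots⟩ := hRH
  have hW := isWeilFactorization_of_isIntegralModel E hE hχ hX hP hroots
  obtain ⟨ι, rfl⟩ : ∃ ι : Fin (2 * (2 * l + 2) + 1), (ι : ℕ) = i := ⟨⟨i, by omega⟩, rfl⟩
  have h := hP ι
  rw [IsIntegralModel, hW.eq_of_ellipticQuadric l hε] at h
  rw [← h]
  dsimp only
  split_ifs
  · exact map_one_sub_C_pow_mul_X_sq_quadric _ _ _
  · exact map_one_sub_C_pow_mul_X_quadric _ _ _
  · exact Polynomial.map_one _

/-- **`P_{2l+2}(ℰ, T) = 1 − q^{2l+2}T² = (1 − q^{l+1}T)(1 + q^{l+1}T)`**: the two inverse roots of weight `2l+2` are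
`q^{l+1}` and `−q^{l+1}` — Frobenius EXCHANGES the two rulings (Kahn's sign `−1`). [cite: Kahn2020, §3.6 Remark 3.66]
[cite: Weil1949, p. 507] -/
theorem frobCharPoly_ellipticQuadric_middle (hE : E.HasLefschetzTraceFormula)
    (hχ : ((χ (arithFrob k) : Kˣ) : K) = Nat.card k) (hε : ¬IsSquare ε)
    (hRH : E.WeilRiemannHypothesisFor
      (hypersurface ((∑ i : Fin (l + 1), MvPolynomial.X (Fin.castLE (leE l) i) *
          MvPolynomial.X (Fin.rev (Fin.castLE (leE l) i))) + MvPolynomial.X (Fin.mk (l + 1) (ltE₁ l)) ^ 2 -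
          MvPolynomial.C ε * MvPolynomial.X (Fin.mk (l + 2) (ltE₂ l)) ^ 2 : MvPolynomial (Fin (2 * l + 2 + 2)) k)) (2 * l + 2)) :
    E.frobCharPoly
        (hypersurface ((∑ i : Fin (l + 1), MvPolynomial.X (Fin.castLE (leE l) i) *
          MvPolynomial.X (Fin.rev (Fin.castLE (leE l) i))) + MvPolynomial.X (Fin.mk (l + 1) (ltE₁ l)) ^ 2 -
          MvPolynomial.C ε * MvPolynomial.X (Fin.mk (l + 2) (ltE₂ l)) ^ 2 : MvPolynomial (Fin (2 * l + 2 + 2)) k)) (2 * (l + 1)) =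
      1 - C ((Nat.card k : K) ^ (2 * (l + 1))) * Polynomial.X ^ 2 ∧
    E.frobCharPoly
        (hypersurface ((∑ i : Fin (l + 1), MvPolynomial.X (Fin.castLE (leE l) i) *
          MvPolynomial.X (Fin.rev (Fin.castLE (leE l) i))) + MvPolynomial.X (Fin.mk (l + 1) (ltE₁ l)) ^ 2 -
          MvPolynomial.C ε * MvPolynomial.X (Fin.mk (l + 2) (ltE₂ l)) ^ 2 : MvPolynomial (Fin (2 * l + 2 + 2)) k)) (2 * (l + 1)) =
      (1 - C ((Nat.card k : K) ^ (l + 1)) * Polynomial.X) * (1 + C ((Nat.card k : K) ^ (l + 1)) * Polynomial.X) := by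
  have h := E.frobCharPoly_ellipticQuadric l hE hχ hε hRH (show 2 * (l + 1) ≤ 2 * (2 * l + 2) by omega)
  rw [if_pos (even_two_mul _), Nat.mul_div_cancel_left _ two_pos, if_pos rfl] at h
  refine ⟨h, ?_⟩
  have hsq : ((Nat.card k : K) ^ (2 * (l + 1))) = ((Nat.card k : K) ^ (l + 1)) ^ 2 := by
    rw [← pow_mul, mul_comm]
  rw [h, hsq, map_pow]
  ring

/-- **`det(T − F | H^{2l+2}(ℰ)) = (T − q^{l+1})(T + q^{l+1})`.** [cite: Kahn2020, §3.6 Remark 3.66] [cite: Deligne1974, Th. (1.6)] -/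
theorem charpoly_frobAction_ellipticQuadric_middle (hE : E.HasLefschetzTraceFormula)
    (hχ : ((χ (arithFrob k) : Kˣ) : K) = Nat.card k) (hε : ¬IsSquare ε)
    (hRH : E.WeilRiemannHypothesisFor
      (hypersurface ((∑ i : Fin (l + 1), MvPolynomial.X (Fin.castLE (leE l) i) *
          MvPolynomial.X (Fin.rev (Fin.castLE (leE l) i))) + MvPolynomial.X (Fin.mk (l + 1) (ltE₁ l)) ^ 2 -
          MvPolynomial.C ε * MvPolynomial.X (Fin.mk (l + 2) (ltE₂ l)) ^ 2 : MvPolynomial (Fin (2 * l + 2 + 2)) k)) (2 * l + 2)) :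
    (haveI := E.finite_obj (isSmoothProjective_ellipticQuadric_of_not_isSquare l hε) (2 * (l + 1));
      (E.frobAction
        (hypersurface ((∑ i : Fin (l + 1), MvPolynomial.X (Fin.castLE (leE l) i) *
          MvPolynomial.X (Fin.rev (Fin.castLE (leE l) i))) + MvPolynomial.X (Fin.mk (l + 1) (ltE₁ l)) ^ 2 -
          MvPolynomial.C ε * MvPolynomial.X (Fin.mk (l + 2) (ltE₂ l)) ^ 2 : MvPolynomial (Fin (2 * l + 2 + 2)) k)) (2 * (l + 1))).charpoly) =
      (Polynomial.X - C ((Nat.card k : K) ^ (l + 1))) * (Polynomial.X - C (-((Nat.card k : K) ^ (l + 1)))) := by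
  have hX := isSmoothProjective_ellipticQuadric_of_not_isSquare l hε
  haveI := E.finite_obj hX (2 * (l + 1))
  have h := (E.frobCharPoly_ellipticQuadric_middle l hE hχ hε hRH).1
  have hsq : ((Nat.card k : K) ^ (2 * (l + 1))) = ((Nat.card k : K) ^ (l + 1)) ^ 2 := by
    rw [← pow_mul, mul_comm]
  rw [E.frobCharPoly_eq hX, hsq, ← reverse_X_sub_C_mul_X_add_C] at h
  have hq : ((Nat.card k : K) ^ (l + 1)) ≠ 0 := pow_ne_zero _ (by exact_mod_cast Nat.card_pos.ne')
  have h0 : ((Polynomial.X - C ((Nat.card k : K) ^ (l + 1))) *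
      (Polynomial.X - C (-((Nat.card k : K) ^ (l + 1))))).coeff 0 ≠ 0 := by
    rw [coeff_zero_eq_eval_zero, eval_mul, eval_sub, eval_sub, eval_X, eval_C, eval_C, zero_sub, zero_sub, neg_neg]
    exact mul_ne_zero (neg_ne_zero.mpr hq) hq
  rw [← Literature.Algebra.Polynomial.ReciprocalPolynomialSplits.reverse_reverse_of_coeff_zero_ne_zero
      (E.charpoly_frobAction_coeff_zero_ne_zero hX (2 * (l + 1))), h,
    Literature.Algebra.Polynomial.ReciprocalPolynomialSplits.reverse_reverse_of_coeff_zero_ne_zero h0]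

/-- **`F² = q^{2l+2}` on `H^{2l+2}(ℰ)`** (Cayley–Hamilton for `(T − q^{l+1})(T + q^{l+1}) = T² − q^{2l+2}`).
[cite: Kahn2020, §3.6 Remark 3.66] [cite: Deligne1974, Th. (1.6)] -/
theorem frobAction_sq_ellipticQuadric_middle (hE : E.HasLefschetzTraceFormula)
    (hχ : ((χ (arithFrob k) : Kˣ) : K) = Nat.card k) (hε : ¬IsSquare ε)
    (hRH : E.WeilRiemannHypothesisFor
      (hypersurface ((∑ i : Fin (l + 1), MvPolynomial.X (Fin.castLE (leE l) i) *
          MvPolynomial.X (Fin.rev (Fin.castLE (leE l) i))) + MvPolynomial.X (Fin.mk (l + 1) (ltE₁ l)) ^ 2 -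
          MvPolynomial.C ε * MvPolynomial.X (Fin.mk (l + 2) (ltE₂ l)) ^ 2 : MvPolynomial (Fin (2 * l + 2 + 2)) k)) (2 * l + 2)) :
    E.frobAction
        (hypersurface ((∑ i : Fin (l + 1), MvPolynomial.X (Fin.castLE (leE l) i) *
          MvPolynomial.X (Fin.rev (Fin.castLE (leE l) i))) + MvPolynomial.X (Fin.mk (l + 1) (ltE₁ l)) ^ 2 -
          MvPolynomial.C ε * MvPolynomial.X (Fin.mk (l + 2) (ltE₂ l)) ^ 2 : MvPolynomial (Fin (2 * l + 2 + 2)) k)) (2 * (l + 1)) ^ 2 =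
      algebraMap K (Module.End K (E.obj
        (hypersurface ((∑ i : Fin (l + 1), MvPolynomial.X (Fin.castLE (leE l) i) *
          MvPolynomial.X (Fin.rev (Fin.castLE (leE l) i))) + MvPolynomial.X (Fin.mk (l + 1) (ltE₁ l)) ^ 2 -
          MvPolynomial.C ε * MvPolynomial.X (Fin.mk (l + 2) (ltE₂ l)) ^ 2 : MvPolynomial (Fin (2 * l + 2 + 2)) k)) (2 * (l + 1)))) ((Nat.card k : K) ^ (2 * (l + 1))) := by
  haveI := E.finite_obj (isSmoothProjective_ellipticQuadric_of_not_isSquare l hε) (2 * (l + 1))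
  have h := LinearMap.aeval_self_charpoly (E.frobAction
    (hypersurface ((∑ i : Fin (l + 1), MvPolynomial.X (Fin.castLE (leE l) i) *
          MvPolynomial.X (Fin.rev (Fin.castLE (leE l) i))) + MvPolynomial.X (Fin.mk (l + 1) (ltE₁ l)) ^ 2 -
          MvPolynomial.C ε * MvPolynomial.X (Fin.mk (l + 2) (ltE₂ l)) ^ 2 : MvPolynomial (Fin (2 * l + 2 + 2)) k)) (2 * (l + 1)))
  -- `(T − q^{l+1})(T + q^{l+1}) = T² − q^{2l+2}` in the commutative ring `K[T]`, then evaluate at `F`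
  have hpoly : (Polynomial.X - C ((Nat.card k : K) ^ (l + 1))) * (Polynomial.X - C (-((Nat.card k : K) ^ (l + 1)))) =
      Polynomial.X ^ 2 - C ((Nat.card k : K) ^ (2 * (l + 1))) := by
    simp only [map_neg, map_pow]
    ring
  rw [E.charpoly_frobAction_ellipticQuadric_middle l hE hχ hε hRH, hpoly, map_sub, map_pow, aeval_X, aeval_C,
    sub_eq_zero] at h
  exact h

/-- **`F` is semisimple on `H^{2l+2}(ℰ)`** (it is killed by the separable polynomial `T² − q^{2l+2}`, `char K = 0`).
[cite: Tate1994, §1 (Conjecture S)] [cite: Kahn2020, §3.6 Remark 3.66] -/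
theorem isSemisimple_frobAction_ellipticQuadric_middle (hE : E.HasLefschetzTraceFormula)
    (hχ : ((χ (arithFrob k) : Kˣ) : K) = Nat.card k) (hε : ¬IsSquare ε)
    (hRH : E.WeilRiemannHypothesisFor
      (hypersurface ((∑ i : Fin (l + 1), MvPolynomial.X (Fin.castLE (leE l) i) *
          MvPolynomial.X (Fin.rev (Fin.castLE (leE l) i))) + MvPolynomial.X (Fin.mk (l + 1) (ltE₁ l)) ^ 2 -
          MvPolynomial.C ε * MvPolynomial.X (Fin.mk (l + 2) (ltE₂ l)) ^ 2 : MvPolynomial (Fin (2 * l + 2 + 2)) k)) (2 * l + 2)) :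
    Module.End.IsSemisimple (E.frobAction
      (hypersurface ((∑ i : Fin (l + 1), MvPolynomial.X (Fin.castLE (leE l) i) *
          MvPolynomial.X (Fin.rev (Fin.castLE (leE l) i))) + MvPolynomial.X (Fin.mk (l + 1) (ltE₁ l)) ^ 2 -
          MvPolynomial.C ε * MvPolynomial.X (Fin.mk (l + 2) (ltE₂ l)) ^ 2 : MvPolynomial (Fin (2 * l + 2 + 2)) k)) (2 * (l + 1))) := by
  haveI := E.finite_obj (isSmoothProjective_ellipticQuadric_of_not_isSquare l hε) (2 * (l + 1))
  have hq : ((Nat.card k : K) ^ (2 * (l + 1))) ≠ 0 := pow_ne_zero _ (by exact_mod_cast Nat.card_pos.ne')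
  refine Module.End.isSemisimple_of_squarefree_aeval_eq_zero
    ((Polynomial.separable_X_pow_sub_C ((Nat.card k : K) ^ (2 * (l + 1))) (n := 2) (by norm_num) hq).squarefree) ?_
  rw [map_sub, map_pow, aeval_X, aeval_C, E.frobAction_sq_ellipticQuadric_middle l hE hχ hε hRH, sub_self]

/-- **`φ_{l+1}² = 1` on `H^{2l+2}(ℰ)(l+1)`** (`φ_{l+1} = q^{−(l+1)}F`, `F² = q^{2l+2}`).
[cite: Kahn2020, §3.6 Remark 3.66] [cite: Tate1994, §1] -/
theorem ρTwist_sq_ellipticQuadric_middle (hE : E.HasLefschetzTraceFormula)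
    (hχ : ((χ (arithFrob k) : Kˣ) : K) = Nat.card k) (hε : ¬IsSquare ε)
    (hRH : E.WeilRiemannHypothesisFor
      (hypersurface ((∑ i : Fin (l + 1), MvPolynomial.X (Fin.castLE (leE l) i) *
          MvPolynomial.X (Fin.rev (Fin.castLE (leE l) i))) + MvPolynomial.X (Fin.mk (l + 1) (ltE₁ l)) ^ 2 -
          MvPolynomial.C ε * MvPolynomial.X (Fin.mk (l + 2) (ltE₂ l)) ^ 2 : MvPolynomial (Fin (2 * l + 2 + 2)) k)) (2 * l + 2)) :
    E.ρTwist
        (hypersurface ((∑ i : Fin (l + 1), MvPolynomial.X (Fin.castLE (leE l) i) *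
          MvPolynomial.X (Fin.rev (Fin.castLE (leE l) i))) + MvPolynomial.X (Fin.mk (l + 1) (ltE₁ l)) ^ 2 -
          MvPolynomial.C ε * MvPolynomial.X (Fin.mk (l + 2) (ltE₂ l)) ^ 2 : MvPolynomial (Fin (2 * l + 2 + 2)) k)) (2 * (l + 1)) (l + 1 : ℕ) (geomFrob k) ^ 2 = 1 := by
  have hq0 : (Nat.card k : K) ≠ 0 := by exact_mod_cast Nat.card_pos.ne'
  have hs : ((Nat.card k : K)⁻¹ ^ (l + 1)) ^ 2 * (Nat.card k : K) ^ (2 * (l + 1)) = 1 := by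
    rw [← pow_mul, mul_comm 2 (l + 1), inv_pow, inv_mul_cancel₀ (pow_ne_zero _ hq0)]
  rw [E.ρTwist_geomFrob_natCast, coe_χ_geomFrob hχ, _root_.smul_pow, E.frobAction_sq_ellipticQuadric_middle l hE hχ hε hRH,
    Algebra.algebraMap_eq_smul_one, smul_smul, hs, one_smul]

/-- **Over `𝔽_{q²}` every middle class of `ℰ` is a Tate class: `φ_{l+1}(F²) = 1` on `H^{2l+2}(ℰ)(l+1)`** — the twisted
action of the Frobenius of `𝔽_{q²}` is trivial, so `Ker(φ_{l+1}(F²) − 1) = H^{2l+2}(ℰ)(l+1)` (both rulings are rational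
over `𝔽_{q²}`; the DOUBLE pole of `Z(ℰ ⊗ 𝔽_{q²}, T)` at `(q²)^{−(l+1)}`, g51-#11 §7). [cite: Kahn2020, §3.6 Remark 3.66]
[cite: TateWoodsHole1965, §3] -/
theorem ρTwist_geomFrob_sq_ellipticQuadric_middle (hE : E.HasLefschetzTraceFormula)
    (hχ : ((χ (arithFrob k) : Kˣ) : K) = Nat.card k) (hε : ¬IsSquare ε)
    (hRH : E.WeilRiemannHypothesisFor
      (hypersurface ((∑ i : Fin (l + 1), MvPolynomial.X (Fin.castLE (leE l) i) *
          MvPolynomial.X (Fin.rev (Fin.castLE (leE l) i))) + MvPolynomial.X (Fin.mk (l + 1) (ltE₁ l)) ^ 2 -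
          MvPolynomial.C ε * MvPolynomial.X (Fin.mk (l + 2) (ltE₂ l)) ^ 2 : MvPolynomial (Fin (2 * l + 2 + 2)) k)) (2 * l + 2)) :
    E.ρTwist
        (hypersurface ((∑ i : Fin (l + 1), MvPolynomial.X (Fin.castLE (leE l) i) *
          MvPolynomial.X (Fin.rev (Fin.castLE (leE l) i))) + MvPolynomial.X (Fin.mk (l + 1) (ltE₁ l)) ^ 2 -
          MvPolynomial.C ε * MvPolynomial.X (Fin.mk (l + 2) (ltE₂ l)) ^ 2 : MvPolynomial (Fin (2 * l + 2 + 2)) k)) (2 * (l + 1)) (l + 1 : ℕ) (geomFrob k ^ 2) = 1 ∧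
    LinearMap.ker (E.ρTwist
        (hypersurface ((∑ i : Fin (l + 1), MvPolynomial.X (Fin.castLE (leE l) i) *
          MvPolynomial.X (Fin.rev (Fin.castLE (leE l) i))) + MvPolynomial.X (Fin.mk (l + 1) (ltE₁ l)) ^ 2 -
          MvPolynomial.C ε * MvPolynomial.X (Fin.mk (l + 2) (ltE₂ l)) ^ 2 : MvPolynomial (Fin (2 * l + 2 + 2)) k)) (2 * (l + 1)) (l + 1 : ℕ) (geomFrob k ^ 2) - 1) = ⊤ := by
  have h : E.ρTwist
        (hypersurface ((∑ i : Fin (l + 1), MvPolynomial.X (Fin.castLE (leE l) i) *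
          MvPolynomial.X (Fin.rev (Fin.castLE (leE l) i))) + MvPolynomial.X (Fin.mk (l + 1) (ltE₁ l)) ^ 2 -
          MvPolynomial.C ε * MvPolynomial.X (Fin.mk (l + 2) (ltE₂ l)) ^ 2 : MvPolynomial (Fin (2 * l + 2 + 2)) k)) (2 * (l + 1)) (l + 1 : ℕ) (geomFrob k ^ 2) = 1 := by
    rw [map_pow, E.ρTwist_sq_ellipticQuadric_middle l hE hχ hε hRH]
  refine ⟨h, ?_⟩
  rw [h, sub_self, LinearMap.ker_zero]

/-- **`φ_{l+1} ≠ 1` on `H^{2l+2}(ℰ)(l+1)`**: the Galois-fixed classes form the line `K·η^{l+1}` (g52-#2), not the plane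
— the class of the second ruling is NOT rational over `𝔽_q`. [cite: Kahn2020, §3.6 Remark 3.66] [cite: TateWoodsHole1965, §3] -/
theorem ρTwist_ellipticQuadric_middle_ne_one (hE : E.HasLefschetzTraceFormula)
    (hχ : ((χ (arithFrob k) : Kˣ) : K) = Nat.card k) (hε : ¬IsSquare ε)
    (hRH : E.WeilRiemannHypothesisFor
      (hypersurface ((∑ i : Fin (l + 1), MvPolynomial.X (Fin.castLE (leE l) i) *
          MvPolynomial.X (Fin.rev (Fin.castLE (leE l) i))) + MvPolynomial.X (Fin.mk (l + 1) (ltE₁ l)) ^ 2 -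
          MvPolynomial.C ε * MvPolynomial.X (Fin.mk (l + 2) (ltE₂ l)) ^ 2 : MvPolynomial (Fin (2 * l + 2 + 2)) k)) (2 * l + 2)) :
    E.ρTwist
        (hypersurface ((∑ i : Fin (l + 1), MvPolynomial.X (Fin.castLE (leE l) i) *
          MvPolynomial.X (Fin.rev (Fin.castLE (leE l) i))) + MvPolynomial.X (Fin.mk (l + 1) (ltE₁ l)) ^ 2 -
          MvPolynomial.C ε * MvPolynomial.X (Fin.mk (l + 2) (ltE₂ l)) ^ 2 : MvPolynomial (Fin (2 * l + 2 + 2)) k)) (2 * (l + 1)) (l + 1 : ℕ) (geomFrob k) ≠ 1 := by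
  have hX := isSmoothProjective_ellipticQuadric_of_not_isSquare l hε
  haveI := E.finite_obj hX (2 * (l + 1))
  intro h1
  have hker : LinearMap.ker (E.ρTwist
      (hypersurface ((∑ i : Fin (l + 1), MvPolynomial.X (Fin.castLE (leE l) i) *
          MvPolynomial.X (Fin.rev (Fin.castLE (leE l) i))) + MvPolynomial.X (Fin.mk (l + 1) (ltE₁ l)) ^ 2 -
          MvPolynomial.C ε * MvPolynomial.X (Fin.mk (l + 2) (ltE₂ l)) ^ 2 : MvPolynomial (Fin (2 * l + 2 + 2)) k)) (2 * (l + 1)) (l + 1 : ℕ) (geomFrob k) - 1) = ⊤ := by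
    rw [h1, sub_self, LinearMap.ker_zero]
  have hdim := (E.finrank_eq_one_of_hasPoleOfOrderAt_one hE hχ hX hRH (show (l + 1) + (l + 1) = 2 * l + 2 by omega)
    (hasPoleOfOrderAt_zetaSeries_ellipticQuadric_middle l hε)).2.1
  rw [hker, finrank_top, E.finrank_ellipticQuadric_middle l hE hχ hε hRH] at hdim
  exact absurd hdim (by norm_num)

/-- **`H^{2l+2}(ℰ)(l+1) = Ker(φ_{l+1} − 1) ⊕ Ker(φ_{l+1} + 1)`**: since `φ² = 1` and `2 ≠ 0` in `K`, every class is the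
sum of an invariant and an anti-invariant one (`x = ½(x + φx) + ½(x − φx)`), and the two eigenspaces meet in `0`.
[cite: Kahn2020, §3.6 Remark 3.66] -/
theorem ker_sub_one_sup_ker_add_one_ellipticQuadric_middle (hE : E.HasLefschetzTraceFormula)
    (hχ : ((χ (arithFrob k) : Kˣ) : K) = Nat.card k) (hε : ¬IsSquare ε)
    (hRH : E.WeilRiemannHypothesisFor
      (hypersurface ((∑ i : Fin (l + 1), MvPolynomial.X (Fin.castLE (leE l) i) *
          MvPolynomial.X (Fin.rev (Fin.castLE (leE l) i))) + MvPolynomial.X (Fin.mk (l + 1) (ltE₁ l)) ^ 2 -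
          MvPolynomial.C ε * MvPolynomial.X (Fin.mk (l + 2) (ltE₂ l)) ^ 2 : MvPolynomial (Fin (2 * l + 2 + 2)) k)) (2 * l + 2)) :
    LinearMap.ker (E.ρTwist
          (hypersurface ((∑ i : Fin (l + 1), MvPolynomial.X (Fin.castLE (leE l) i) *
          MvPolynomial.X (Fin.rev (Fin.castLE (leE l) i))) + MvPolynomial.X (Fin.mk (l + 1) (ltE₁ l)) ^ 2 -
          MvPolynomial.C ε * MvPolynomial.X (Fin.mk (l + 2) (ltE₂ l)) ^ 2 : MvPolynomial (Fin (2 * l + 2 + 2)) k)) (2 * (l + 1)) (l + 1 : ℕ) (geomFrob k) - 1) ⊔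
        LinearMap.ker (E.ρTwist
          (hypersurface ((∑ i : Fin (l + 1), MvPolynomial.X (Fin.castLE (leE l) i) *
          MvPolynomial.X (Fin.rev (Fin.castLE (leE l) i))) + MvPolynomial.X (Fin.mk (l + 1) (ltE₁ l)) ^ 2 -
          MvPolynomial.C ε * MvPolynomial.X (Fin.mk (l + 2) (ltE₂ l)) ^ 2 : MvPolynomial (Fin (2 * l + 2 + 2)) k)) (2 * (l + 1)) (l + 1 : ℕ) (geomFrob k) + 1) = ⊤ ∧
    LinearMap.ker (E.ρTwist
          (hypersurface ((∑ i : Fin (l + 1), MvPolynomial.X (Fin.castLE (leE l) i) *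
          MvPolynomial.X (Fin.rev (Fin.castLE (leE l) i))) + MvPolynomial.X (Fin.mk (l + 1) (ltE₁ l)) ^ 2 -
          MvPolynomial.C ε * MvPolynomial.X (Fin.mk (l + 2) (ltE₂ l)) ^ 2 : MvPolynomial (Fin (2 * l + 2 + 2)) k)) (2 * (l + 1)) (l + 1 : ℕ) (geomFrob k) - 1) ⊓
        LinearMap.ker (E.ρTwist
          (hypersurface ((∑ i : Fin (l + 1), MvPolynomial.X (Fin.castLE (leE l) i) *
          MvPolynomial.X (Fin.rev (Fin.castLE (leE l) i))) + MvPolynomial.X (Fin.mk (l + 1) (ltE₁ l)) ^ 2 -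
          MvPolynomial.C ε * MvPolynomial.X (Fin.mk (l + 2) (ltE₂ l)) ^ 2 : MvPolynomial (Fin (2 * l + 2 + 2)) k)) (2 * (l + 1)) (l + 1 : ℕ) (geomFrob k) + 1) = ⊥ := by
  set φ := E.ρTwist
    (hypersurface ((∑ i : Fin (l + 1), MvPolynomial.X (Fin.castLE (leE l) i) *
          MvPolynomial.X (Fin.rev (Fin.castLE (leE l) i))) + MvPolynomial.X (Fin.mk (l + 1) (ltE₁ l)) ^ 2 -
          MvPolynomial.C ε * MvPolynomial.X (Fin.mk (l + 2) (ltE₂ l)) ^ 2 : MvPolynomial (Fin (2 * l + 2 + 2)) k)) (2 * (l + 1)) (l + 1 : ℕ) (geomFrob k) with hφ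
  have hsq : φ * φ = 1 := by rw [← pow_two]; exact E.ρTwist_sq_ellipticQuadric_middle l hE hχ hε hRH
  have hφφ : ∀ x, φ (φ x) = x := fun x => by
    rw [← Module.End.mul_apply, hsq, Module.End.one_apply]
  constructor
  · rw [eq_top_iff]
    rintro x -
    have hx : x = (2 : K)⁻¹ • (x + φ x) + (2 : K)⁻¹ • (x - φ x) := by
      rw [← smul_add, add_add_sub_cancel, ← two_smul K x, smul_smul, inv_mul_cancel₀ (two_ne_zero' K), one_smul]
    rw [hx]
    refine Submodule.add_mem_sup (Submodule.smul_mem _ _ ?_) (Submodule.smul_mem _ _ ?_)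
    · rw [LinearMap.mem_ker, LinearMap.sub_apply, Module.End.one_apply, map_add, hφφ, sub_eq_zero]
      exact add_comm _ _
    · rw [LinearMap.mem_ker, LinearMap.add_apply, Module.End.one_apply, map_sub, hφφ]
      abel
  · rw [eq_bot_iff]
    intro x hx
    obtain ⟨h1, h2⟩ := Submodule.mem_inf.mp hx
    rw [LinearMap.mem_ker, LinearMap.sub_apply, Module.End.one_apply, sub_eq_zero] at h1
    rw [LinearMap.mem_ker, LinearMap.add_apply, Module.End.one_apply, h1, ← two_smul K x,
      smul_eq_zero_iff_right (two_ne_zero' K)] at h2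
    rw [h2]
    exact Submodule.zero_mem _

/-- **The anti-invariant middle classes of `ℰ` form a line: `dim Ker(φ_{l+1} + 1) = 1`** (the class of the difference of
the two rulings, on which Frobenius acts by `−1`), complementary to the invariant line `Ker(φ_{l+1} − 1) = K·η^{l+1}`.
[cite: Kahn2020, §3.6 Remark 3.66] [cite: Tate1994, §2 Th. 2.9] -/
theorem finrank_ker_ρTwist_add_one_ellipticQuadric_middle (hE : E.HasLefschetzTraceFormula)
    (hχ : ((χ (arithFrob k) : Kˣ) : K) = Nat.card k) (hε : ¬IsSquare ε)
    (hRH : E.WeilRiemannHypothesisFor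
      (hypersurface ((∑ i : Fin (l + 1), MvPolynomial.X (Fin.castLE (leE l) i) *
          MvPolynomial.X (Fin.rev (Fin.castLE (leE l) i))) + MvPolynomial.X (Fin.mk (l + 1) (ltE₁ l)) ^ 2 -
          MvPolynomial.C ε * MvPolynomial.X (Fin.mk (l + 2) (ltE₂ l)) ^ 2 : MvPolynomial (Fin (2 * l + 2 + 2)) k)) (2 * l + 2)) :
    Module.finrank K (LinearMap.ker (E.ρTwist
        (hypersurface ((∑ i : Fin (l + 1), MvPolynomial.X (Fin.castLE (leE l) i) *
          MvPolynomial.X (Fin.rev (Fin.castLE (leE l) i))) + MvPolynomial.X (Fin.mk (l + 1) (ltE₁ l)) ^ 2 -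
          MvPolynomial.C ε * MvPolynomial.X (Fin.mk (l + 2) (ltE₂ l)) ^ 2 : MvPolynomial (Fin (2 * l + 2 + 2)) k)) (2 * (l + 1)) (l + 1 : ℕ) (geomFrob k) + 1)) = 1 ∧
    Module.finrank K (LinearMap.ker (E.ρTwist
        (hypersurface ((∑ i : Fin (l + 1), MvPolynomial.X (Fin.castLE (leE l) i) *
          MvPolynomial.X (Fin.rev (Fin.castLE (leE l) i))) + MvPolynomial.X (Fin.mk (l + 1) (ltE₁ l)) ^ 2 -
          MvPolynomial.C ε * MvPolynomial.X (Fin.mk (l + 2) (ltE₂ l)) ^ 2 : MvPolynomial (Fin (2 * l + 2 + 2)) k)) (2 * (l + 1)) (l + 1 : ℕ) (geomFrob k) - 1)) = 1 := by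
  have hX := isSmoothProjective_ellipticQuadric_of_not_isSquare l hε
  haveI := E.finite_obj hX (2 * (l + 1))
  have h1 := (E.finrank_eq_one_of_hasPoleOfOrderAt_one hE hχ hX hRH (show (l + 1) + (l + 1) = 2 * l + 2 by omega)
    (hasPoleOfOrderAt_zetaSeries_ellipticQuadric_middle l hε)).2.1
  obtain ⟨hsup, hinf⟩ := E.ker_sub_one_sup_ker_add_one_ellipticQuadric_middle l hE hχ hε hRH
  have hdim := Submodule.finrank_sup_add_finrank_inf_eq
    (LinearMap.ker (E.ρTwist
      (hypersurface ((∑ i : Fin (l + 1), MvPolynomial.X (Fin.castLE (leE l) i) *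
          MvPolynomial.X (Fin.rev (Fin.castLE (leE l) i))) + MvPolynomial.X (Fin.mk (l + 1) (ltE₁ l)) ^ 2 -
          MvPolynomial.C ε * MvPolynomial.X (Fin.mk (l + 2) (ltE₂ l)) ^ 2 : MvPolynomial (Fin (2 * l + 2 + 2)) k)) (2 * (l + 1)) (l + 1 : ℕ) (geomFrob k) - 1))
    (LinearMap.ker (E.ρTwist
      (hypersurface ((∑ i : Fin (l + 1), MvPolynomial.X (Fin.castLE (leE l) i) *
          MvPolynomial.X (Fin.rev (Fin.castLE (leE l) i))) + MvPolynomial.X (Fin.mk (l + 1) (ltE₁ l)) ^ 2 -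
          MvPolynomial.C ε * MvPolynomial.X (Fin.mk (l + 2) (ltE₂ l)) ^ 2 : MvPolynomial (Fin (2 * l + 2 + 2)) k)) (2 * (l + 1)) (l + 1 : ℕ) (geomFrob k) + 1))
  rw [hsup, hinf, finrank_top, finrank_bot, E.finrank_ellipticQuadric_middle l hE hχ hε hRH, h1] at hdim
  exact ⟨by omega, h1⟩

end EllipticQuadric

end GaloisWeilCohomology

end Literature.AlgebraicGeometry.Motives

end
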